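/-
Copyright (c) 2026 the pub-hodgecm-mathlib formalisation cell (harness21).  Prover seat hodgecm-mathlib-LH10-p01 (g11), 2026-09-03.  Road M6 «ROW 2 ★ DYADIC TWIN» → F3
«TOT-Λ BY OVER-ORDERS» (LEAD F0P3a-plan T14-66 ∕ T15-08), carve (c10b-S) «GATE AT b = 0, SUFFICIENCY» (F3-5 pen LH7-p04 (g12) 00:24:06Z; holder F0P3a-p02 (g27),
sigsheet SIG-c10b-S v1 ad4dff8922f419ee), split (S2) «NORM SUPPLY» (this file; offer 00:33:42Z, taken 00:34:02Z; citation census LH4-p01 (g10) 00:39:30Z).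
-/
import Mathlib.RingTheory.Valuation.Integers
import Mathlib.Topology.Algebra.Valued.ValuativeRel
import Mathlib.Algebra.GroupWithZero.WithZero
import HarnessLib

/-!
# Norm supply in a quadratic field with involution: `σ_K`-fixed elements with the valuation of a norm are norms

Topic `NumberTheory/Automorphic`; namespace `Literature.NumberTheory.Automorphic`.  THEOREMS ONLY (no definition, no instance, no notation, no named fact, no `sorry`);
kernel lane `--supports stmt-HodgeConjecture-24833`.  Cell `pub/hodgecm-mathlib` (D-0151), crux H413 = `stmt-HodgeConjecture-24833`; road M6 → F3 «TOT-Λ by over-orders»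
(route (B)), carve (c10b) «GATE AT GLUE DEPTH `b = 0`», sufficiency half (holder F0P3a-p02 (g27): (S3-W) `SelfDualProductOrderGateWitness`, (S3-A) assembly): the
`K`-plane witness needs a `b₂ ∈ K` with `b₂·σ_K(b₂) = ν` for the `σ_K`-FIXED element `ν` of ★ (S1) `SelfDualProductOrderKLine` (`kLine_map_nu`).  THIS FILE is split (S2)
«NORM SUPPLY»: in the abstract local frame of ★ F3-1a ∕ ★ (UG-idx) — a field `K` with a valuation `v`, a ring involution `σ_K`, and the ONE arithmetic letter those files carry,
**`hnorm₁`: every `σ_K`-fixed UNIT is a norm `t·σ_K(t)`** (★ `QuadraticEisensteinOrderNormIndex` ∕ `GluedOverOrderBoundaryIndex` ∕ `GluedOverOrderUnitaryGenerator` binder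
`hnorm₁ : ∀ z : O₁, IsUnit z → σ₁ z = z → ∃ w, w * σ₁ w = z`, discharged at the places by ★ F4-a′ `TypeTwoEigenFieldPackageUniformiser` conjunct (nK)) — it proves that a
`σ_K`-fixed `c ≠ 0` is a norm as soon as its valuation is the valuation of SOME norm `x·σ_K(x)`; in particular the uniformiser `ϖ` of the base is a norm (`x := θ`, `θ·σ_Kθ = θ²`,
`|θ²| = |ϖ|` in the ramified quadratic algebra `θ² = aθ + k`, `|aθ| < |k| = |ϖ|` — EVERY row, `a = 0` or not), hence every `σ_K`-fixed `c` with `|c| ∈ |ϖ|^ℤ`, and — in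
`ℤᵐ⁰`-currency with `|θ| = exp(−1)` — every `σ_K`-fixed `c` of EVEN order (the ★ package's (nK) spelling `∃ a, a·σ_K(a)·c = 1` included).  No new arithmetic input beyond `hnorm₁`
(LH4-p01 (g10) census 00:39:30Z).
HONEST LABEL: HC_CM is proved only modulo the 7 printed citations (2 remaining named inputs: hLiu418 = stmt-HodgeConjecture-24832, h413 = stmt-HodgeConjecture-24833) until
rung 0 closes; elementary valuation algebra, asserts nothing printed; count-neutral (zero label movement until F5 ★ and a desk-priced rider).

THE MATHEMATICS.  `σ_K` an involution (`hσσ`).  If `σ_K c = c`, `c ≠ 0`, and `|x·σ_K x| = |c|`, then `u := c·(x·σ_K x)⁻¹` is a `σ_K`-fixed unit (`σ_K(x·σ_K x) = x·σ_K x`), so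
`u = s·σ_K s` (`hnorm₁`) and `t := s·x` has `t·σ_K t = u·x·σ_K x = c`.  Rows: `x := θ` (`σ_Kθ = θ`, `|θ·θ| = |ϖ|`) gives `ϖ = t₀·σ_K t₀`; `x := t₀^j` gives every `σ_K`-fixed `c`
with `|c| = |ϖ|^j` (`j ∈ ℤ`); `x := θ^{−r}` gives every `σ_K`-fixed `c` with `log|c| = r + r` when `|θ| = exp(−1)`.  The `𝒪[K]`-unit letter of ★ (UG-idx) yields the field-level
`hnorm₁` (a valuation-`1` element is an integral unit), for the valuative relation's own valuation and for any compatible one.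
[cite: SerreLocalFields1979, Ch. V §2 Prop. 3] [cite: Jacobowitz1962, §5] [cite: Neukirch1999, Ch. II §4–§5]

* §1 `exists_mul_map_eq_of_valuation_eq` (the supply lemma), `exists_mul_map_eq_of_map_mul_self` (`x := θ`: the base uniformiser is a norm),
  `valuation_mul_self_eq_of_lt` (`|θ·θ| = |k|` from `θ² = aθ + k`, `|aθ| < |k|`), `exists_mul_map_eq_of_valuation_eq_zpow` ∕ `_pow` (`|c| = |ϖ|^j`),
  `exists_mul_map_mul_eq_one_iff` (the two spellings `∃ t, t·σt = c` ∕ `∃ a, a·σa·c = 1`), `exists_mul_map_eq_of_even_log` (+ `…_mul_eq_one_of_even_log`, the (nK) spelling).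
* §2 `exists_mul_map_eq_of_units_integer` (field-level `hnorm₁` from the `𝒪[K]`-unit letter), `valuation_eq_one_iff_of_compatible`, `exists_mul_map_eq_of_units_integer_of_compatible`.

## References
* [SerreLocalFields1979] J.-P. Serre, *Local Fields*, GTM 67 (1979): Ch. V §2 Prop. 3 (norms of units in quadratic extensions of local fields), Ch. V §3.
* [Jacobowitz1962] R. Jacobowitz, *Hermitian forms over local fields*, Amer. J. Math. 84 (1962): §5 (norm groups `N(K^×)` at ramified ∕ unramified `K∕K₀`; the norm-class of the
  determinant).
* [Neukirch1999] J. Neukirch, *Algebraic Number Theory*, Grundlehren 322 (1999): Ch. II §4–§5 (valuations, units `= ϖ^ℤ × 𝒪^×`), Ch. V §1 (norm residue symbol of a local quadratic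
  extension).
-/

set_option autoImplicit false

noncomputable section

open scoped ValuativeRel _root_.WithZero

namespace Literature.NumberTheory.Automorphic

/-! ## §1 The supply lemma and its rows -/

section Supply

variable {K : Type*} [Field K] {Γ₀ : Type*} [LinearOrderedCommGroupWithZero Γ₀] (v : Valuation K Γ₀) (σK : K →+* K) (hσσ : ∀ x, σK (σK x) = x)
  (hnorm₁ : ∀ u : K, v u = 1 → σK u = u → ∃ t : K, t * σK t = u)

include hσσ hnorm₁ in
/-- **NORM SUPPLY**: if `σ_K c = c`, `c ≠ 0`, and `|x·σ_K(x)| = |c|` for some `x`, then `c = t·σ_K(t)` — `c·(x σ_K x)⁻¹` is a `σ_K`-fixed unit, hence a norm (`hnorm₁`), and norms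
multiply. [cite: SerreLocalFields1979, Ch. V §2 Prop. 3] [cite: Jacobowitz1962, §5] -/
theorem exists_mul_map_eq_of_valuation_eq (x c : K) (hc0 : c ≠ 0) (hσc : σK c = c) (hx : v (x * σK x) = v c) : ∃ t : K, t * σK t = c := by
  have hvc : v c ≠ 0 := (Valuation.ne_zero_iff v).2 hc0
  have hn0 : x * σK x ≠ 0 := fun h0 => by rw [h0, map_zero] at hx; exact hvc hx.symm
  set u : K := c * (x * σK x)⁻¹ with hu
  have hu1 : v u = 1 := by
    rw [hu, map_mul, map_inv₀, hx, mul_inv_cancel₀ hvc]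
  have hσu : σK u = u := by
    rw [hu, map_mul, map_inv₀, map_mul, hσσ, hσc, mul_comm (σK x) x]
  obtain ⟨s, hs⟩ := hnorm₁ u hu1 hσu
  refine ⟨s * x, ?_⟩
  rw [map_mul, mul_mul_mul_comm, hs, hu, inv_mul_cancel_right₀ hn0]

include hσσ hnorm₁ in
/-- **THE BASE UNIFORMISER IS A NORM** (row `x := θ`): if `σ_K θ = θ` and `|θ·θ| = |ϖ|` (the ramified quadratic algebra `θ² = aθ + k`, `|aθ| < |k| = |ϖ|` — every row, `a = 0` or
not; see `valuation_mul_self_eq_of_lt`), then every `σ_K`-fixed `ϖ ≠ 0` with that valuation is `t·σ_K(t)`. [cite: SerreLocalFields1979, Ch. V §2 Prop. 3, §3]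
[cite: Neukirch1999, Ch. V §1] -/
theorem exists_mul_map_eq_of_map_mul_self (θ ϖ : K) (hσθ : σK θ = θ) (hϖ0 : ϖ ≠ 0) (hσϖ : σK ϖ = ϖ) (hθϖ : v (θ * θ) = v ϖ) :
    ∃ t : K, t * σK t = ϖ :=
  exists_mul_map_eq_of_valuation_eq v σK hσσ hnorm₁ θ ϖ hϖ0 hσϖ (by rw [hσθ, hθϖ])

/-- `|θ·θ| = |k|` when `θ·θ = a·θ + k` with `|a·θ| < |k|` (ultrametric inequality; in the application `a, k ∈ 𝔪`, `|k| = |ϖ|`, `|θ| < 1`).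
[cite: Neukirch1999, Ch. II §4–§5] -/
theorem valuation_mul_self_eq_of_lt (θ α κ : K) (hθ : θ * θ = α * θ + κ) (hlt : v (α * θ) < v κ) : v (θ * θ) = v κ := by
  rw [hθ, Valuation.map_add_eq_of_lt_right _ hlt]

include hσσ hnorm₁ in
/-- **ROW `|c| = |ϖ|^j`, `j ∈ ℤ`**: with `ϖ = t₀·σ_K(t₀)` (`exists_mul_map_eq_of_map_mul_self`), every `σ_K`-fixed `c ≠ 0` with `|c| = |ϖ|^j` is a norm (`x := t₀^j`).
[cite: SerreLocalFields1979, Ch. V §2 Prop. 3] [cite: Neukirch1999, Ch. II §5] -/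
theorem exists_mul_map_eq_of_valuation_eq_zpow (t₀ ϖ : K) (ht₀ : t₀ * σK t₀ = ϖ) (c : K) (hc0 : c ≠ 0) (hσc : σK c = c) (j : ℤ)
    (hcv : v c = v ϖ ^ j) : ∃ t : K, t * σK t = c :=
  exists_mul_map_eq_of_valuation_eq v σK hσσ hnorm₁ (t₀ ^ j) c hc0 hσc (by rw [map_zpow₀ σK, ← mul_zpow, ht₀, map_zpow₀, hcv])

include hσσ hnorm₁ in
/-- Row `|c| = |ϖ|^n`, `n ∈ ℕ` (`x := t₀^n`). [cite: SerreLocalFields1979, Ch. V §2 Prop. 3] -/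
theorem exists_mul_map_eq_of_valuation_eq_pow (t₀ ϖ : K) (ht₀ : t₀ * σK t₀ = ϖ) (c : K) (hc0 : c ≠ 0) (hσc : σK c = c) (n : ℕ)
    (hcv : v c = v ϖ ^ n) : ∃ t : K, t * σK t = c :=
  exists_mul_map_eq_of_valuation_eq v σK hσσ hnorm₁ (t₀ ^ n) c hc0 hσc (by rw [map_pow, ← mul_pow, ht₀, map_pow, hcv])

/-- **THE TWO SPELLINGS**: for `c ≠ 0`, `(∃ t, t·σ_K t = c) ↔ (∃ a, a·σ_K a·c = 1)` (`a = t⁻¹`; the right-hand side is ★ F4-a′ `exists_eigenField_package_uniformiser`'s (nK) ∕ ★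
`InertPlaceSkewDiscriminantRoot.exists_mul_galAdicCompletionMap_mul_eq_one_of_even`'s spelling). [cite: Jacobowitz1962, §5] -/
theorem exists_mul_map_mul_eq_one_iff (c : K) (hc0 : c ≠ 0) : (∃ t : K, t * σK t = c) ↔ ∃ a : K, a * σK a * c = 1 := by
  constructor
  · rintro ⟨t, ht⟩
    have ht0 : t ≠ 0 := fun h0 => hc0 (by rw [← ht, h0, zero_mul])
    refine ⟨t⁻¹, ?_⟩
    rw [map_inv₀, ← ht, ← mul_inv, inv_mul_cancel₀ (ht.symm ▸ hc0 : t * σK t ≠ 0)]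
  · rintro ⟨a, ha⟩
    refine ⟨a⁻¹, ?_⟩
    rw [map_inv₀, ← mul_inv]
    exact (eq_inv_of_mul_eq_one_right ha).symm

end Supply

/-! ### The `ℤᵐ⁰` row: even order -/

section EvenLog

variable {K : Type*} [Field K] (v : Valuation K ℤᵐ⁰) (σK : K →+* K) (hσσ : ∀ x, σK (σK x) = x)
  (hnorm₁ : ∀ u : K, v u = 1 → σK u = u → ∃ t : K, t * σK t = u)

include hσσ hnorm₁ in
/-- **ROW «EVEN ORDER»** (`ℤᵐ⁰`-currency, `K` normalised by `|θ| = exp(−1)` for a `σ_K`-fixed `θ` — the ★ F4-a′ package's `Valued.v θ = exp(−1)`): every `σ_K`-fixed `c ≠ 0` with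
`log|c|` EVEN is a norm `t·σ_K(t)` (`log|c| = r + r`, `x := θ^{−r}`). [cite: SerreLocalFields1979, Ch. V §2 Prop. 3, §3] [cite: Jacobowitz1962, §5] -/
theorem exists_mul_map_eq_of_even_log (θ : K) (hσθ : σK θ = θ) (hθv : v θ = WithZero.exp (-1 : ℤ)) (c : K) (hc0 : c ≠ 0) (hσc : σK c = c)
    (heven : Even (WithZero.log (v c))) : ∃ t : K, t * σK t = c := by
  obtain ⟨r, hr⟩ := heven
  have hvc : v c ≠ 0 := (Valuation.ne_zero_iff v).2 hc0
  refine exists_mul_map_eq_of_valuation_eq v σK hσσ hnorm₁ (θ ^ (-r)) c hc0 hσc ?_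
  rw [map_zpow₀ σK, hσθ, map_mul, map_zpow₀, hθv, ← WithZero.exp_zsmul, ← WithZero.exp_add, ← WithZero.exp_log hvc, hr]
  congr 1
  simp only [smul_eq_mul, mul_neg, mul_one, neg_neg]

include hσσ hnorm₁ in
/-- The same in the (nK) spelling `∃ a, a·σ_K(a)·c = 1`. [cite: SerreLocalFields1979, Ch. V §2 Prop. 3] [cite: Jacobowitz1962, §5] -/
theorem exists_mul_map_mul_eq_one_of_even_log (θ : K) (hσθ : σK θ = θ) (hθv : v θ = WithZero.exp (-1 : ℤ)) (c : K) (hc0 : c ≠ 0) (hσc : σK c = c)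
    (heven : Even (WithZero.log (v c))) : ∃ a : K, a * σK a * c = 1 :=
  (exists_mul_map_mul_eq_one_iff σK c hc0).1 (exists_mul_map_eq_of_even_log v σK hσσ hnorm₁ θ hσθ hθv c hc0 hσc heven)

end EvenLog

/-! ## §2 The field-level `hnorm₁` from the `𝒪[K]`-unit letter of ★ (UG-idx) -/

section Bridge

variable {K : Type*} [Field K] [ValuativeRel K] (σK : K →+* K)
  (σ₁ : 𝒪[K] →+* 𝒪[K]) (hσ₁ : ∀ z : 𝒪[K], ((σ₁ z : 𝒪[K]) : K) = σK z)
  (hnorm₁O : ∀ z : 𝒪[K], IsUnit z → σ₁ z = z → ∃ w : 𝒪[K], w * σ₁ w = z)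

include hσ₁ hnorm₁O in
/-- **FIELD-LEVEL `hnorm₁` FROM THE INTEGRAL LETTER**: if every `σ₁`-fixed UNIT of `𝒪[K]` is `w·σ₁(w)` (★ (UG-idx) ∕ F3-1a binder `hnorm₁` at `O₁ := 𝒪[K]`, `σ₁ = σ_K|𝒪`), then every
`σ_K`-fixed `u ∈ K` of valuation `1` is `t·σ_K(t)` (a valuation-`1` element is an integral unit). [cite: SerreLocalFields1979, Ch. V §2 Prop. 3] [cite: Neukirch1999, Ch. II §4] -/
theorem exists_mul_map_eq_of_units_integer : ∀ u : K, ValuativeRel.valuation K u = 1 → σK u = u → ∃ t : K, t * σK t = u := by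
  intro u hu hσu
  have huO : u ∈ 𝒪[K] := (Valuation.mem_integer_iff _ _).2 hu.le
  set z : 𝒪[K] := ⟨u, huO⟩ with hz
  have hzU : IsUnit z := Valuation.Integers.isUnit_of_one' (Valuation.integer.integers (ValuativeRel.valuation K)) (x := z) hu
  have hσz : σ₁ z = z := Subtype.ext (by rw [hσ₁]; exact hσu)
  obtain ⟨w, hw⟩ := hnorm₁O z hzU hσz
  refine ⟨(w : K), ?_⟩
  have h := congrArg Subtype.val hw
  rw [Subring.coe_mul, hσ₁] at h
  exact h

/-- For a valuation `v` compatible with the valuative relation, `v u = 1 ↔ valuation K u = 1` (so the field-level `hnorm₁` may be stated with either). [cite: Neukirch1999, Ch. II §4] -/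
theorem valuation_eq_one_iff_of_compatible {Γ₀ : Type*} [LinearOrderedCommGroupWithZero Γ₀] (v : Valuation K Γ₀) [v.Compatible] (u : K) :
    v u = 1 ↔ ValuativeRel.valuation K u = 1 := by
  rw [← map_one v, ← Valuation.veq_iff_eq v, Valuation.veq_iff_eq (ValuativeRel.valuation K), map_one]

include hσ₁ hnorm₁O in
/-- The field-level `hnorm₁` for ANY compatible valuation `v` (e.g. `Valued.v : K → ℤᵐ⁰`). [cite: SerreLocalFields1979, Ch. V §2 Prop. 3] -/
theorem exists_mul_map_eq_of_units_integer_of_compatible {Γ₀ : Type*} [LinearOrderedCommGroupWithZero Γ₀] (v : Valuation K Γ₀) [v.Compatible] :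
    ∀ u : K, v u = 1 → σK u = u → ∃ t : K, t * σK t = u := fun u hu hσu =>
  exists_mul_map_eq_of_units_integer σK σ₁ hσ₁ hnorm₁O u ((valuation_eq_one_iff_of_compatible v u).1 hu) hσu

end Bridge

end Literature.NumberTheory.Automorphic

end
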